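import Summits.BirchSwinnertonDyer.BirchSwinnertonDyer.Theorems.ResidualThetaTransportAtTwoResidualSignedLambdaLowerCMAtTwoCofreeSelmerTransfer
import Summits.BirchSwinnertonDyer.BirchSwinnertonDyer.Theorems.ResidualThetaTransportAtTwoResidualSignedLambdaLowerCMAtTwoCofreeSelmerTransferKummer
import HarnessLib

/-!
# The item-6 COMPOSITE: a level class whose Shapiro lift lies in the dual Selmer structure AND whose localisation at every `v ∣ p` is a
# Θ-transported layer Kummer class of SIGNED points transfers into the first THREE clauses of RSL_g's counted set

Route `ResidualThetaTransportAtTwo` (RTT), crux RSL_g `ResidualSignedLambdaLowerCMAtTwo` (stmt-BirchSwinnertonDyer-22608), line «onepair», S57 split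
item 6 (S4₂ `stub_deepHalfAtTwoStrict`); seat `prover-bsd-wall-tp2-p2x-w2` g19 (`--supports`, closes nothing). THEOREMS ONLY (no definition, no
named fact, no instance, no `sorry`). STUB-PLAN rev 19 Q79 / S78 (P-k3g13-1): «the item-6 composite carries a 4th hypothesis [kum] (TP2 socket shape)
and concludes the plus clause». BSD is not proved by any of this; RSL_g (22608) stays OPEN.

WHAT.
* §1 **`transferH1_mem_signed_of_shapiroLift`** = `transferH1_mem_relaxed_of_shapiroLift` (file `…CofreeSelmerTransfer`, hypotheses [unr] `hur`,
  [inf] `hinf` = LOCAL CONDITIONS on the Shapiro lift `Sh c`) + T3♮ `exists_signed_thetaKummerWitness_conjH1_transfer` (file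
  `…CofreeSelmerTransferKummer`, hypothesis [kum]: at every `v ∣ p` a tuple of SIGNED layer points `Q₀ ∈ E^ε(ℚ_{n,v})^r` with
  `layerLocOf … v n c = thetaLayerKummer … (Θ v hv) … Q₀`) ⟹ the transferred class `τ_n c = res_{Γ_∞ ≤ Γ_n}((A_ρ[p^k] ↪ A_ρ)_* c)` lies in
  `{y | (1) y ∈ unramifiedOutside Γ_∞ A_ρ p S₀ ∧ (2) ∀ w σ, conj_σ y ∈ infKer Γ_∞ A_ρ w ∧ (3) ∀ v ∣ p, ∀ σ, ∃ (φ, Q, k), [φ] = conj_σ y ∧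
  p^k Q i ∈ ⨆_m E^ε(ℚ_{m,v}) ∧ ι(Θ v hv (φ(res τ)) i) = τ Q_i − Q_i}` — VERBATIM the first three clauses of RSL_g's counted set (there `p = 2`,
  `ε = 1`, rank `n`); the transport is the crux-shaped FAMILY `Θ v hv` with its equivariance `hΘ v hv`. The fourth clause (`ϖ`-torsion) is the
  holder's (`zsmul_transferH1_eq_zero` gives `p^k • τ_n c = 0`). **`transferH1_mem_signed_strict_of_shapiroLift`** (item 7): with [p]
  `loc_v (Sh c) = 0` at `v ∣ p` instead of [kum], clause (3) holds with the ZERO points (any `ε`, any `Θ`) and (3′) every conjugate lies in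
  `awayKer Γ_∞ A_ρ v`.
* §2 the two-line glue of the decomposition (k3-g13 §5, dropped from file A for size): `levelwise_orthogonal_of_transfer[_strict]` —
  Λ-adic orthogonality over the relaxed set + (T) + the pairing readback ⟹ levelwise orthogonality (hypothesis (ii) of the one
  `SelmerComplement` / Poitou–Tate call per `(n,k)`).

References: [Kobayashi2003] Def. 1.1, §2 (p. 4), (8.23) (p. 18); [GreenbergVatsal2000] §2 pp. 16–17, 23; [Greenberg1989] §1 p. 98 (3);
[NeukirchSchmidtWingberg2008] I §6 (1.6.4); [MilneADT2006] I 4.10 (b); [Rubin2000] App. B §B.3.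
-/

set_option autoImplicit false
-- the Theorems namespace of this sub repeats the summit name by design (D-0017 nested layout)
set_option linter.dupNamespace false

noncomputable section

open scoped Classical NumberField

namespace Summit.BirchSwinnertonDyer.BirchSwinnertonDyer.Theorems.ThetaTransport.CofreeSelmerTransfer

open CategoryTheory Field NumberField IsDedekindDomain
  Literature.NumberTheory.EllipticCurves Literature.NumberTheory.GaloisRepresentations
  Literature.NumberTheory.EllipticCurves.Kobayashi2003 Literature.NumberTheory.EllipticCurves.GreenbergVatsal2000
  Literature.NumberTheory.EllipticCurves.GreenbergSelmer Literature.NumberTheory.EllipticCurves.CyclotomicLayer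
  Literature.NumberTheory.GaloisCohomology ZpExtension
  Literature.NumberTheory.GaloisRepresentations.DiscreteGaloisModule
  Summit.BirchSwinnertonDyer.BirchSwinnertonDyer.Theorems

/-! ## §1 The item-6 composite: [unr] ∧ [inf] ∧ [kum] ⟹ clauses (1) ∧ (2) ∧ (3) -/

section Shapiro

variable {p : ℕ} [Fact p.Prime] (S : Set (PadicAlgCl p)) {d : ℕ} (ρ : FramedGaloisRep ℚ ↥(padicCoeffIntegers S) d)
  (k : ℕ) (W : WeierstrassCurve ℚ) [W.IsElliptic] {r : ℕ} (κ : ZpExtension ℚ p) (n : ℕ)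
  (Θ : ∀ v : HeightOneSpectrum (𝓞 ℚ), (p : 𝓞 ℚ) ∈ v.asIdeal →
    (Cofree ρ ↥(padicCoeffField S) ≃+ (Fin r → ↥(W.geomPrimaryTorsion p))))
  (hΘ : ∀ (v : HeightOneSpectrum (𝓞 ℚ)) (hv : (p : 𝓞 ℚ) ∈ v.asIdeal) (δ : absoluteGaloisGroup (v.adicCompletion ℚ))
    (m : Cofree ρ ↥(padicCoeffField S)) (i : Fin r),
    Θ v hv (resGalOfEmb (closureEmb (K := ℚ) (v.adicCompletion ℚ)) δ • m) i =
      resGalOfEmb (closureEmb (K := ℚ) (v.adicCompletion ℚ)) δ • Θ v hv m i)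
  [Fintype (absoluteGaloisGroup ℚ ⧸ κ.layerSubgroup n)]
  {s : absoluteGaloisGroup ℚ ⧸ κ.layerSubgroup n → absoluteGaloisGroup ℚ}
  (hs : ∀ x : absoluteGaloisGroup ℚ ⧸ κ.layerSubgroup n, (s x : absoluteGaloisGroup ℚ ⧸ κ.layerSubgroup n) = x)
  (hs1 : s ((1 : absoluteGaloisGroup ℚ) : absoluteGaloisGroup ℚ ⧸ κ.layerSubgroup n) = 1)
  {S₀ : Set (HeightOneSpectrum (𝓞 ℚ))}

include hΘ in
/-- **Item-6 composite ([unr] ∧ [inf] ∧ [kum] ⟹ clauses (1) ∧ (2) ∧ (3) of RSL_g's counted set).** For `c ∈ H¹(Γ_n, A_ρ[p^k])` whose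
Shapiro lift is unramified at the finite `w ∉ S₀ ∪ {p}` and zero at the infinite places (membership in the DUAL structure of the level call),
and whose localisation at every `v ∣ p` is the Θ-transported layer Kummer class of SIGNED points `Q₀ ∈ E^ε(ℚ_{n,v})^r`, the transferred class
`τ_n c ∈ H¹(Γ_∞, A_ρ)` satisfies clauses (1) (unramified outside `p ∪ S₀`), (2) (archimedean) and (3) (the SIGNED Kummer clause through the
transport family `Θ v hv`, for every conjugate). [cite: GreenbergVatsal2000, §2 pp. 16–17, 23] [cite: Greenberg1989, §1 p. 98 (3)]
[cite: Kobayashi2003, Def. 1.1, (8.23) (p. 18)] [cite: NeukirchSchmidtWingberg2008, I §6 Prop. (1.6.4)] -/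
theorem transferH1_mem_signed_of_shapiroLift (hκ : κ.IsCyclotomic) (ε : ℤˣ)
    (hρ : ∀ w : HeightOneSpectrum (𝓞 ℚ), w ∉ S₀ → ((p : ℕ) : 𝓞 ℚ) ∉ w.asIdeal → ρ.IsUnramifiedAt w)
    (c : H1 (cofreeTorsionGaloisModule S ρ ((p ^ k : ℕ) : ℤ)) (κ.layerSubgroup n))
    (hur : ∀ w : HeightOneSpectrum (𝓞 ℚ), w ∉ S₀ → ((p : ℕ) : 𝓞 ℚ) ∉ w.asIdeal →
      galoisCohomology.localization
          ((cofreeTorsionGaloisModule S ρ ((p ^ k : ℕ) : ℤ)).coind (κ.layerSubgroup n) (κ.isOpen_layerSubgroup n)) (Sum.inr w) 1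
          (shapiroLift (cofreeTorsionGaloisModule S ρ ((p ^ k : ℕ) : ℤ)).toTopRep (κ.layerSubgroup n) (κ.isOpen_layerSubgroup n)
            hs hs1 c) ∈
        unramifiedSubgroup (GaloisRep.toLocal w
          ((cofreeTorsionGaloisModule S ρ ((p ^ k : ℕ) : ℤ)).coind (κ.layerSubgroup n) (κ.isOpen_layerSubgroup n))) 1)
    (hinf : ∀ w : InfinitePlace ℚ,
      galoisCohomology.localization
          ((cofreeTorsionGaloisModule S ρ ((p ^ k : ℕ) : ℤ)).coind (κ.layerSubgroup n) (κ.isOpen_layerSubgroup n)) (Sum.inl w) 1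
          (shapiroLift (cofreeTorsionGaloisModule S ρ ((p ^ k : ℕ) : ℤ)).toTopRep (κ.layerSubgroup n) (κ.isOpen_layerSubgroup n)
            hs hs1 c) = 0)
    (hkum : ∀ (v : HeightOneSpectrum (𝓞 ℚ)) (hv : (p : 𝓞 ℚ) ∈ v.asIdeal),
      ∃ Q₀ : Fin r → ↥(localLayerPointsOfEmb κ (closureEmb (K := ℚ) (v.adicCompletion ℚ)) W n),
        (∀ i, (Q₀ i : localPoints W (v.adicCompletion ℚ)) ∈ signedLocalPoints κ (v.adicCompletion ℚ) W ε n) ∧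
        layerLocOf (cofreeTorsionGaloisModule S ρ ((p ^ k : ℕ) : ℤ)) κ v n c =
          thetaLayerKummer S ρ k W (Θ v hv) κ v (hΘ v hv) n Q₀) :
    resOfLe (Cofree ρ ↥(padicCoeffField S)) (κ.kerSubgroup_le_layerSubgroup n)
        (pushH1 (κ.layerSubgroup n) (AddSubgroup.torsionBy (Cofree ρ ↥(padicCoeffField S)) ((p ^ k : ℕ) : ℤ)).subtype
          (torsionBy_subtype_smul S ρ ((p ^ k : ℕ) : ℤ)) c) ∈
      {y : subgroupH1 κ.kerSubgroup (Cofree ρ ↥(padicCoeffField S)) |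
        y ∈ unramifiedOutside κ.kerSubgroup (Cofree ρ ↥(padicCoeffField S)) p S₀ ∧
        (∀ w σ, conjH1 κ.kerSubgroup (Cofree ρ ↥(padicCoeffField S)) σ y ∈
          infKer κ.kerSubgroup (Cofree ρ ↥(padicCoeffField S)) w) ∧
        ∀ (v : HeightOneSpectrum (𝓞 ℚ)) (hv : (p : 𝓞 ℚ) ∈ v.asIdeal) (σ : absoluteGaloisGroup ℚ),
          ∃ (φ : contOneCocycles (discreteTopRep κ.kerSubgroup (Cofree ρ ↥(padicCoeffField S))))
            (Q : Fin r → localPoints W (v.adicCompletion ℚ)) (k' : ℕ),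
            oneCocycleClass (discreteTopRep κ.kerSubgroup (Cofree ρ ↥(padicCoeffField S))) φ =
              conjH1 κ.kerSubgroup (Cofree ρ ↥(padicCoeffField S)) σ y ∧
            (∀ i, (p ^ k') • Q i ∈ ⨆ m : ℕ, signedLocalPoints κ (v.adicCompletion ℚ) W ε m) ∧
            ∀ (τ : localSubgroupOfEmb κ.kerSubgroup (closureEmb (K := ℚ) (v.adicCompletion ℚ))) (i : Fin r),
              pointsMapOfEmb W (closureEmb (K := ℚ) (v.adicCompletion ℚ))
                  ((Θ v hv (φ.1 (resGalSubgroupOfEmb κ.kerSubgroup (closureEmb (K := ℚ) (v.adicCompletion ℚ)) τ)) i :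
                    ↥(W.geomPrimaryTorsion p)) : W.geomPoints) =
                (τ : absoluteGaloisGroup (v.adicCompletion ℚ)) • Q i - Q i} := by
  obtain ⟨h1, h2⟩ := transferH1_mem_relaxed_of_shapiroLift S ρ κ ((p ^ k : ℕ) : ℤ) n hs hs1 hρ c hur hinf
  refine ⟨h1, h2, fun v hv σ ↦ ?_⟩
  obtain ⟨Q₀, hQ₀, hk⟩ := hkum v hv
  exact exists_signed_thetaKummerWitness_conjH1_transfer S ρ k W (Θ v hv) κ v (hΘ v hv) hκ hv ε n c Q₀ hQ₀ hk σ

omit [W.IsElliptic] in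
/-- **Item-7 composite ([unr] ∧ [inf] ∧ [p] ⟹ clauses (1) ∧ (2) ∧ (3) ∧ (3′)): the SIGNED Kummer clause holds with the ZERO points.**
For `c ∈ H¹(Γ_n, A_ρ[p^k])` whose Shapiro lift is unramified at the finite `w ∉ S₀ ∪ {p}`, zero at the infinite places AND zero at the
places `v ∣ p`, the transferred class `τ_n c` satisfies clauses (1), (2), the signed Kummer clause (3) for ANY sign `ε` and ANY transport family
`Θ v hv` — with witness `(ψ, Q := 0, k := 0)`, `ψ` a representative of `conj_σ (τ_n c)` VANISHING on `Γ_∞ ∩ D_v` (B2,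
`exists_rep_vanishing_conjH1_transferH1`; the image of `Gal(ℚ̄_v/ℚ_{∞,v})` lies in `D_v`, `Kobayashi2003.resGalOfEmb_mem_decomp`) — and (3′) every
conjugate lies in `awayKer Γ_∞ A_ρ v`. [cite: Greenberg1989, §1 p. 98] [cite: SerreGaloisCohomology1997, I §2.6 (b)] [cite: MilneADT2006, I 4.10 (b)] -/
theorem transferH1_mem_signed_strict_of_shapiroLift (ε : ℤˣ)
    (hρ : ∀ w : HeightOneSpectrum (𝓞 ℚ), w ∉ S₀ → ((p : ℕ) : 𝓞 ℚ) ∉ w.asIdeal → ρ.IsUnramifiedAt w)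
    (c : H1 (cofreeTorsionGaloisModule S ρ ((p ^ k : ℕ) : ℤ)) (κ.layerSubgroup n))
    (hur : ∀ w : HeightOneSpectrum (𝓞 ℚ), w ∉ S₀ → ((p : ℕ) : 𝓞 ℚ) ∉ w.asIdeal →
      galoisCohomology.localization
          ((cofreeTorsionGaloisModule S ρ ((p ^ k : ℕ) : ℤ)).coind (κ.layerSubgroup n) (κ.isOpen_layerSubgroup n)) (Sum.inr w) 1
          (shapiroLift (cofreeTorsionGaloisModule S ρ ((p ^ k : ℕ) : ℤ)).toTopRep (κ.layerSubgroup n) (κ.isOpen_layerSubgroup n)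
            hs hs1 c) ∈
        unramifiedSubgroup (GaloisRep.toLocal w
          ((cofreeTorsionGaloisModule S ρ ((p ^ k : ℕ) : ℤ)).coind (κ.layerSubgroup n) (κ.isOpen_layerSubgroup n))) 1)
    (hinf : ∀ w : InfinitePlace ℚ,
      galoisCohomology.localization
          ((cofreeTorsionGaloisModule S ρ ((p ^ k : ℕ) : ℤ)).coind (κ.layerSubgroup n) (κ.isOpen_layerSubgroup n)) (Sum.inl w) 1
          (shapiroLift (cofreeTorsionGaloisModule S ρ ((p ^ k : ℕ) : ℤ)).toTopRep (κ.layerSubgroup n) (κ.isOpen_layerSubgroup n)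
            hs hs1 c) = 0)
    (hp : ∀ v : HeightOneSpectrum (𝓞 ℚ), ((p : ℕ) : 𝓞 ℚ) ∈ v.asIdeal →
      galoisCohomology.localization
          ((cofreeTorsionGaloisModule S ρ ((p ^ k : ℕ) : ℤ)).coind (κ.layerSubgroup n) (κ.isOpen_layerSubgroup n)) (Sum.inr v) 1
          (shapiroLift (cofreeTorsionGaloisModule S ρ ((p ^ k : ℕ) : ℤ)).toTopRep (κ.layerSubgroup n) (κ.isOpen_layerSubgroup n)
            hs hs1 c) = 0) :
    resOfLe (Cofree ρ ↥(padicCoeffField S)) (κ.kerSubgroup_le_layerSubgroup n)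
        (pushH1 (κ.layerSubgroup n) (AddSubgroup.torsionBy (Cofree ρ ↥(padicCoeffField S)) ((p ^ k : ℕ) : ℤ)).subtype
          (torsionBy_subtype_smul S ρ ((p ^ k : ℕ) : ℤ)) c) ∈
      {y : subgroupH1 κ.kerSubgroup (Cofree ρ ↥(padicCoeffField S)) |
        y ∈ unramifiedOutside κ.kerSubgroup (Cofree ρ ↥(padicCoeffField S)) p S₀ ∧
        (∀ w σ, conjH1 κ.kerSubgroup (Cofree ρ ↥(padicCoeffField S)) σ y ∈
          infKer κ.kerSubgroup (Cofree ρ ↥(padicCoeffField S)) w) ∧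
        (∀ (v : HeightOneSpectrum (𝓞 ℚ)) (hv : (p : 𝓞 ℚ) ∈ v.asIdeal) (σ : absoluteGaloisGroup ℚ),
          ∃ (φ : contOneCocycles (discreteTopRep κ.kerSubgroup (Cofree ρ ↥(padicCoeffField S))))
            (Q : Fin r → localPoints W (v.adicCompletion ℚ)) (k' : ℕ),
            oneCocycleClass (discreteTopRep κ.kerSubgroup (Cofree ρ ↥(padicCoeffField S))) φ =
              conjH1 κ.kerSubgroup (Cofree ρ ↥(padicCoeffField S)) σ y ∧
            (∀ i, (p ^ k') • Q i ∈ ⨆ m : ℕ, signedLocalPoints κ (v.adicCompletion ℚ) W ε m) ∧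
            ∀ (τ : localSubgroupOfEmb κ.kerSubgroup (closureEmb (K := ℚ) (v.adicCompletion ℚ))) (i : Fin r),
              pointsMapOfEmb W (closureEmb (K := ℚ) (v.adicCompletion ℚ))
                  ((Θ v hv (φ.1 (resGalSubgroupOfEmb κ.kerSubgroup (closureEmb (K := ℚ) (v.adicCompletion ℚ)) τ)) i :
                    ↥(W.geomPrimaryTorsion p)) : W.geomPoints) =
                (τ : absoluteGaloisGroup (v.adicCompletion ℚ)) • Q i - Q i) ∧
        ∀ v, ((p : ℕ) : 𝓞 ℚ) ∈ v.asIdeal → ∀ σ, conjH1 κ.kerSubgroup (Cofree ρ ↥(padicCoeffField S)) σ y ∈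
          awayKer κ.kerSubgroup (Cofree ρ ↥(padicCoeffField S)) v} := by
  obtain ⟨h1, h2, h3⟩ := transferH1_mem_relaxed_strict_of_shapiroLift S ρ κ ((p ^ k : ℕ) : ℤ) n hs hs1 hρ c hur hinf hp
  refine ⟨h1, h2, fun v hv σ ↦ ?_, h3⟩
  obtain ⟨ψ, hψ, h0⟩ := exists_rep_vanishing_conjH1_transferH1 S ρ κ ((p ^ k : ℕ) : ℤ) n v σ c
    (ThetaTransport.ShapiroTransport.resOfLe_decomp_conjH1_eq_zero_of_localization_shapiroLift_eq_zero S ρ _ κ n hs hs1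
      v c (hp v hv) σ)
  refine ⟨ψ, 0, 0, hψ, fun i ↦ ?_, fun τ i ↦ ?_⟩
  · rw [Pi.zero_apply, smul_zero]
    exact zero_mem _
  · rw [h0 _ (Kobayashi2003.resGalOfEmb_mem_decomp v (τ : absoluteGaloisGroup (v.adicCompletion ℚ))), map_zero,
      Pi.zero_apply, ZeroMemClass.coe_zero, map_zero, Pi.zero_apply, smul_zero, sub_zero]

end Shapiro

/-! ## §2 GLUE: Λ-adic orthogonality + (T) + readback ⟹ levelwise orthogonality (hypothesis (ii) of the level call) -/

section Glue

variable {Hn Hinf R : Type*} [Zero R]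

-- adapted from `Cruxes/ResidualThetaCountLowerPureAtTwo/Sketch_sidea_k3_g13.lean` §5 (GLUE-67 / GLUE-7; statements and proofs unchanged)
/-- **GLUE-67 (items 6/7).** Abstractly: `Adm ⊆ Hn` the admissible level classes, `Rel ⊆ Hinf` the relaxed Λ-adic Selmer set, `τ : Hn → Hinf` the
transfer with (T) `τ '' Adm ⊆ Rel`, `C : Hinf → R` the Λ-adic functional (`s ↦ c₂ z (loc₂ s)` for item 6, `s ↦ cS χ (locS s)` for item 7) with the
item's hypothesis (H) `C = 0` on `Rel`, and `P : Hn → R` the level pairing with the READBACK (R) `P b = C (τ b)` on `Adm`. Then `P = 0` on `Adm` —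
hypothesis (ii) of the ONE `SelmerComplement` call per `(n,k)`. [cite: MilneADT2006, I 4.10 (b)] [cite: Rubin2000, App. B §B.3] -/
theorem levelwise_orthogonal_of_transfer (Adm : Set Hn) (Rel : Set Hinf) (τ : Hn → Hinf) (C : Hinf → R) (P : Hn → R)
    (hT : ∀ b ∈ Adm, τ b ∈ Rel) (hH : ∀ s ∈ Rel, C s = 0) (hR : ∀ b ∈ Adm, P b = C (τ b)) :
    ∀ b ∈ Adm, P b = 0 :=
  fun b hb ↦ (hR b hb).trans (hH _ (hT b hb))

/-- **GLUE-7 (item 7's guarded hypothesis).** The same with the strictness guard: (H′) `C s = 0` only for `s ∈ Rel` with `Str s`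
(«`loc₂ s = 0`»), and (T′) `τ` maps `Adm` into `Rel ∩ Str` (`transferH1_mem_relaxed_strict`). [cite: MilneADT2006, I 4.10 (b)] -/
theorem levelwise_orthogonal_of_transfer_strict (Adm : Set Hn) (Rel Str : Set Hinf) (τ : Hn → Hinf) (C : Hinf → R)
    (P : Hn → R) (hT : ∀ b ∈ Adm, τ b ∈ Rel ∧ τ b ∈ Str) (hH : ∀ s ∈ Rel, s ∈ Str → C s = 0)
    (hR : ∀ b ∈ Adm, P b = C (τ b)) : ∀ b ∈ Adm, P b = 0 :=
  fun b hb ↦ (hR b hb).trans (hH _ (hT b hb).1 (hT b hb).2)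

end Glue

end Summit.BirchSwinnertonDyer.BirchSwinnertonDyer.Theorems.ThetaTransport.CofreeSelmerTransfer

end
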